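import Summits.CriticalPhenomena.PercolationContinuityZ3.Theorems.PercNearOneGluingNoHeavyLowerTailSahiGridPatternCoCountProductNCrossedAlignedGeneral
import Summits.CriticalPhenomena.PercolationContinuityZ3.Theorems.PercNearOneGluingNoHeavyLowerTailSahiGridPatternTwoSetsTop
import Summits.CriticalPhenomena.PercolationContinuityZ3.Theorems.PercNearOneGluingNoHeavyLowerTailSahiGridPatternCellAtoms

/-!
# `NoHeavyLowerTail` (crux stmt-CriticalPhenomena-4575), Sahi programme P1: **KLEITMAN AT EVERY THIRD POINT** — for ANY two up-sets `X, Y ⊆ [3]^k` and any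
# nonnegative weight `φ`:  `Σ_{q ∈ X, r ∈ Y, q δ̸ r} φ(q̄r) ≤ Σ_{m ∈ X ∩ Y} Σ_{s δ̸ m} φ(s)`;  hence CONJECTURE A FOR `x ∨ y` AT EVERY CROSSED PAIR WHOSE SECTIONS SIT
# INSIDE THE TWO ARMS OF `V = ↑a ∪ ↑b` (disjoint supports): `A₀ ⊆ ↑a`, `B′ ⊆ ↑b` ARBITRARY up-sets — every `k`, every certificate

Support file (Sahi cell, seat `prim-sahi-p1`, generation 42; `--supports stmt-CriticalPhenomena-4575`).  Pure proofs, no definitions, no `sorry`, standard axioms.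
Vocabulary of `…SahiGridPattern{,CellForm,CellAtoms,TwoSetsTop,FrozenCorner,CoCountProductNCrossed,CoCountProductNCrossedAligned(General)}`.

THE MATHEMATICS (seat memo FROM-prim-sahi-p1-gen42 §8 (F2), general form).  Group the totally distinct pairs `(q,r)` by their third point `s = q̄r`: for fixed `s`,
`r = s̄q` is determined by `q δ̸ s`, so  `Σ_{q∈X, r∈Y, q δ̸ r, q̄r = s} 1 = #{q ∈ X : q δ̸ s, s̄q ∈ Y}`, while `#{m ∈ X∩Y : m δ̸ s}` counts the same cube around `s`
with `Y` in place of its ANTIPODAL image — and `#{q ∈ X ∩ C_s : s̄q ∈ Y} ≤ #{q ∈ X ∩ Y ∩ C_s}` is exactly the Kleitman sum `Σ_q [q δ̸ s] 1_X(q)(1_Y(q) − 1_Y(s̄q)) ≥ 0`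
(`sum_klCoef_ind_nonneg`, generation 11).  Hence **`pairThird_sum_le_inter`** (the generation-42 'mixing injection' `pairThird_sum_le_mixCorner` is its principal
special case).  With `φ = 1 − 1_V` and `X ⊆ V`: `κ′_V(X,Y) ≤ H_V(X ∩ Y)` — CONJECTURE (F2) of the memo, now a theorem for all up-sets.  Feeding it (instead of the
mixing injection) into the frozen-corner argument of `…CoCountProductNCrossedAlignedGeneral` gives **`diagCert_coProduct_N_orTwo_crossed_twoArms`**: for
`V = ↑a ∪ ↑b` with disjoint supports, ANY up-sets `A₀ ⊆ ↑a` and `B′ ⊆ B = ↑b`, and every `d_V` with (T),(N), the co-count product `(x∨y, c) ⊗ (V, d_V)` satisfies (N)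
at the crossed pair `P = {x≥1}×A₀`, `Q = {q∈B′} ∪ ({y≥1}×B)`; and `sStarD ≥ 0` there (`…_twoArms_nonneg`).  Nothing here asserts Conjecture A in general or
`PatternPos d` for `d ≥ 4`. [this work]
-/

namespace Summit.CriticalPhenomena.PercolationContinuityZ3.Theorems.SahiGridPattern

open Finset SahiGrid3
open scoped BigOperators

section PairThird

variable {k : ℕ}

/-- **Kleitman at every third point**: for up-sets `X, Y` and `φ ≥ 0`,
`Σ_{q,r} 1_X(q) 1_Y(r) [q δ̸ r] φ(q̄r) ≤ Σ_{m,s} 1_X(m) 1_Y(m) [m δ̸ s] φ(s)`. [this work] -/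
theorem pairThird_sum_le_inter {X Y : Finset (Pd k)} (hX : IsUpperSet (X : Set (Pd k))) (hY : IsUpperSet (Y : Set (Pd k)))
    (φ : Pd k → ℤ) (hφ : ∀ s, 0 ≤ φ s) :
    (∑ q : Pd k, ∑ r : Pd k, ind X q * ind Y r * (if TotDist q r = true then (1:ℤ) else 0) * φ (thirdPt q r))
      ≤ ∑ m : Pd k, ∑ s : Pd k, ind X m * ind Y m * (if TotDist m s = true then (1:ℤ) else 0) * φ s := by
  classical
  -- reindex the inner sum of the left side by the involution r ↦ q̄r
  have hinv : ∀ q : Pd k, Function.Involutive (fun r : Pd k => thirdPt q r) := fun q r => thirdPt_thirdPt q r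
  have hL : ∀ q : Pd k, (∑ r : Pd k, ind X q * ind Y r * (if TotDist q r = true then (1:ℤ) else 0) * φ (thirdPt q r))
      = ∑ s : Pd k, ind X q * ind Y (thirdPt q s) * (if TotDist q s = true then (1:ℤ) else 0) * φ s := by
    intro q
    rw [← Equiv.sum_comp (hinv q).toPerm (fun s => ind X q * ind Y (thirdPt q s) * (if TotDist q s = true then (1:ℤ) else 0) * φ s)]
    refine Finset.sum_congr rfl fun r _ => ?_
    show ind X q * ind Y r * (if TotDist q r = true then (1:ℤ) else 0) * φ (thirdPt q r)
      = ind X q * ind Y (thirdPt q (thirdPt q r)) * (if TotDist q (thirdPt q r) = true then (1:ℤ) else 0) * φ (thirdPt q r)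
    rw [thirdPt_thirdPt, totDist_thirdPt_right]
  rw [Finset.sum_congr rfl fun q _ => hL q, Finset.sum_comm]
  conv_rhs => rw [Finset.sum_comm]
  refine Finset.sum_le_sum fun s _ => ?_
  -- at the third point s: Kleitman  Σ_q [q δ̸ s] 1_X(q) (1_Y(q) − 1_Y(q̄s... )) ≥ 0
  have hK := sum_klCoef_ind_nonneg hY hX s
  have e : (∑ r : Pd k, klCoef Y s r * ind X r)
      = (∑ q : Pd k, ind X q * ind Y q * (if TotDist q s = true then (1:ℤ) else 0))
        - ∑ q : Pd k, ind X q * ind Y (thirdPt q s) * (if TotDist q s = true then (1:ℤ) else 0) := by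
    rw [← Finset.sum_sub_distrib]
    refine Finset.sum_congr rfl fun q _ => ?_
    unfold klCoef
    rw [thirdPt_comm q s]
    split_ifs <;> ring
  rw [e] at hK
  have h1 : (∑ q : Pd k, ind X q * ind Y (thirdPt q s) * (if TotDist q s = true then (1:ℤ) else 0) * φ s)
      = φ s * ∑ q : Pd k, ind X q * ind Y (thirdPt q s) * (if TotDist q s = true then (1:ℤ) else 0) := by
    rw [Finset.mul_sum]; refine Finset.sum_congr rfl fun q _ => ?_; ring
  have h2 : (∑ q : Pd k, ind X q * ind Y q * (if TotDist q s = true then (1:ℤ) else 0) * φ s)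
      = φ s * ∑ q : Pd k, ind X q * ind Y q * (if TotDist q s = true then (1:ℤ) else 0) := by
    rw [Finset.mul_sum]; refine Finset.sum_congr rfl fun q _ => ?_; ring
  rw [h1, h2]
  exact mul_le_mul_of_nonneg_left (by linarith) (hφ s)

end PairThird

section TwoArms

variable {k : ℕ} {S Fx Gy : Finset (Pd (1 + 1))} {V : Finset (Pd k)} {A : Finset (Pd ((1 + 1) + k))}

/-- **THEOREM (Conjecture A for `x ∨ y` at every crossed pair with sections inside the two arms; every `k`, every certificate with (T),(N)).**
`V = ↑a ∪ ↑b` (`a` supported on `Sx`, `b` off `Sx`), `A₀` ANY up-set with `A₀ ⊆ ↑a`, `B = ↑b`, `B′` ANY up-set with `B′ ⊆ B`. [this work] -/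
theorem diagCert_coProduct_N_orTwo_crossed_twoArms (hS : ∀ ξ η : Pd 1, glue ξ η ∈ S ↔ (1 ≤ ξ 0 ∨ 1 ≤ η 0))
    (hFx : ∀ ξ η : Pd 1, glue ξ η ∈ Fx ↔ 1 ≤ ξ 0) (hGy : ∀ ξ η : Pd 1, glue ξ η ∈ Gy ↔ 1 ≤ η 0)
    (hA : ∀ σ z, glue σ z ∈ A ↔ (σ ∈ S ∧ z ∈ V))
    (dS : Pd (1 + 1) → ℤ) (hdS : dS (glue (fun _ => 0) (fun _ => 0)) = 0 ∧ dS (glue (fun _ => 0) (fun _ => 1)) = 4 ∧ dS (glue (fun _ => 0) (fun _ => 2)) = 4 ∧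
      dS (glue (fun _ => 1) (fun _ => 0)) = 2 ∧ dS (glue (fun _ => 1) (fun _ => 1)) = 5 ∧ dS (glue (fun _ => 1) (fun _ => 2)) = 5 ∧
      dS (glue (fun _ => 2) (fun _ => 0)) = 2 ∧ dS (glue (fun _ => 2) (fun _ => 1)) = 5 ∧ dS (glue (fun _ => 2) (fun _ => 2)) = 5)
    {a b : Pd k} {Sx : Finset (Fin k)} (hVm : ∀ q, q ∈ V ↔ (a ≤ q ∨ b ≤ q))
    (haS : ∀ i, i ∉ Sx → a i = 0) (hbS : ∀ i, i ∈ Sx → b i = 0)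
    {A0 Bp B0 : Finset (Pd k)} (hA0u : IsUpperSet (A0 : Set (Pd k))) (hA0a : ∀ q ∈ A0, a ≤ q) (hB0 : ∀ q, q ∈ B0 ↔ b ≤ q)
    (hBpu : IsUpperSet (Bp : Set (Pd k))) (hsub : Bp ⊆ B0)
    (dV : Pd k → ℤ)
    (hTV : ∀ W : Finset (Pd k), IsUpperSet (W : Set (Pd k)) → (∑ q ∈ W, dV q) ≤ ∑ q ∈ W, lamU V q)
    (hNV : ∀ X X' : Finset (Pd k), IsUpperSet (X : Set (Pd k)) → IsUpperSet (X' : Set (Pd k)) → (∑ q ∈ X, ∑ r ∈ X', thetaVal V q r) ≤ ∑ q ∈ X ∩ X', dV q)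
    {P Q : Finset (Pd ((1 + 1) + k))} (hP : ∀ σ q, glue σ q ∈ P ↔ (σ ∈ Fx ∧ q ∈ A0)) (hQ : ∀ σ q, glue σ q ∈ Q ↔ (q ∈ Bp ∨ (σ ∈ Gy ∧ q ∈ B0))) :
    (∑ x ∈ P, ∑ y ∈ Q, thetaVal A x y) ≤ ∑ x ∈ P ∩ Q, (2 * (2:ℤ) ^ ((1 + 1) + k) * (ind S (freeOf x) * ind V (cellOf x))
        - (2 * (2:ℤ) ^ (1 + 1) * ind S (freeOf x) - dS (freeOf x)) * (2 * (2:ℤ) ^ k * ind V (cellOf x) - dV (cellOf x))) := by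
  classical
  have hVu : IsUpperSet (V : Set (Pd k)) := isUpperSet_of_mem_iff_le_or hVm
  have hB0u : IsUpperSet (B0 : Set (Pd k)) := isUpperSet_of_mem_iff_le hB0
  have hA0V : ∀ q, q ∈ A0 → q ∈ V := fun q hq => (hVm q).2 (Or.inl (hA0a q hq))
  have hFcorner : ∀ q ∈ A0 ∩ Bp, a ≤ q ∧ b ≤ q := by
    intro q hq
    rw [Finset.mem_inter] at hq
    exact ⟨hA0a q hq.1, (hB0 q).1 (hsub hq.2)⟩
  have hfro := diagCert_sum_eq_on_corner hVm haS hbS dV hTV hNV hFcorner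
  set tV : Pd k → Pd k → ℤ := fun q r => if TotDist q r = true then (1:ℤ) else 0 with htV
  set a1 : ℤ := ∑ q : Pd k, ∑ r : Pd k, ind A0 q * ind B0 r * tV q r * ind V q with ha1
  set a2 : ℤ := ∑ q : Pd k, ∑ r : Pd k, ind A0 q * ind B0 r * tV q r * ind V r with ha2
  set b1 : ℤ := ∑ q : Pd k, ∑ r : Pd k, ind A0 q * ind Bp r * tV q r * ind V q with hb1
  set b2 : ℤ := ∑ q : Pd k, ∑ r : Pd k, ind A0 q * ind Bp r * tV q r * ind V r with hb2
  set mb : ℤ := ∑ q : Pd k, ∑ r : Pd k, ind A0 q * ind Bp r * tV q r * ind V (thirdPt q r) with hmb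
  set nB : ℤ := ∑ q : Pd k, ind A0 q * ind B0 q * ind V q with hnB
  set nBp : ℤ := ∑ q : Pd k, ind A0 q * ind Bp q * ind V q with hnBp
  set yBp : ℤ := ∑ q : Pd k, ind A0 q * ind Bp q * dV q with hyBp
  have hH1 : a1 ≤ 2 ^ k * nB := pairCount_le_harris hVu hA0u hB0u
  have hH2 : a2 ≤ 2 ^ k * nB := pairCount_le_harris' hVu hA0u hB0u
  have hH3 : b2 ≤ 2 ^ k * nBp := pairCount_le_harris' hVu hA0u hBpu
  have hK : mb ≤ b1 := latCount_le_pairCount hVu hA0u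
  have hindV : ∀ q, ind A0 q * ind V q = ind A0 q := by
    intro q
    unfold ind
    by_cases hq : q ∈ A0
    · rw [if_pos hq, if_pos (hA0V q hq)]; ring
    · rw [if_neg hq]; ring
  set Γ : ℤ := ∑ m : Pd k, ∑ s : Pd k, ind A0 m * ind Bp m * tV m s * (1 - ind V s) with hΓ
  have hmix : b1 - mb ≤ Γ := by
    have h := pairThird_sum_le_inter hA0u hBpu (fun s => 1 - ind V s) (fun s => by unfold ind; split_ifs <;> norm_num)
    have e1 : (∑ q : Pd k, ∑ r : Pd k, ind A0 q * ind Bp r * (if TotDist q r = true then (1:ℤ) else 0) * (1 - ind V (thirdPt q r))) = b1 - mb := by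
      rw [hb1, hmb, ← Finset.sum_sub_distrib]
      refine Finset.sum_congr rfl fun q _ => ?_
      rw [← Finset.sum_sub_distrib]
      refine Finset.sum_congr rfl fun r _ => ?_
      have := hindV q
      calc ind A0 q * ind Bp r * (if TotDist q r = true then (1:ℤ) else 0) * (1 - ind V (thirdPt q r))
          = (ind A0 q * ind V q) * ind Bp r * tV q r - ind A0 q * ind Bp r * tV q r * ind V (thirdPt q r) := by rw [this]; simp only [htV]; ring
        _ = ind A0 q * ind Bp r * tV q r * ind V q - ind A0 q * ind Bp r * tV q r * ind V (thirdPt q r) := by ring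
    rw [e1] at h
    exact h
  have hfro' : yBp = 2 ^ k * nBp + Γ := by
    have e1 : (∑ q ∈ A0 ∩ Bp, dV q) = yBp := by
      rw [hyBp, sum_mem_eq_sum_ind_mul (A0 ∩ Bp)]
      refine Finset.sum_congr rfl fun q _ => ?_
      rw [ind_inter_eq_mul]
    have e2 : (∑ q ∈ A0 ∩ Bp, lamU V q) = ∑ q : Pd k, ind A0 q * ind Bp q * lamU V q := by
      rw [sum_mem_eq_sum_ind_mul (A0 ∩ Bp)]
      refine Finset.sum_congr rfl fun q _ => ?_
      rw [ind_inter_eq_mul]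
    have e3 : ∀ q : Pd k, ind A0 q * ind Bp q * lamU V q = 2 ^ k * (ind A0 q * ind Bp q * ind V q) + ∑ s : Pd k, ind A0 q * ind Bp q * tV q s * (1 - ind V s) := by
      intro q
      unfold lamU
      rw [nuCount_eq_sum_ind]
      have htot : (∑ s : Pd k, tV q s) = 2 ^ k := by
        simp only [htV]
        have := sum_ite_totDist_eq_pow q
        rw [← this]
        refine Finset.sum_congr rfl fun s _ => ?_
        rw [totDist_symm]
      have hnu : (∑ p : Pd k, ind V p * (if TotDist p q = true then (1:ℤ) else 0)) = ∑ s : Pd k, tV q s * ind V s := by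
        refine Finset.sum_congr rfl fun s _ => ?_
        simp only [htV]; rw [totDist_symm]; ring
      rw [hnu]
      have hsplit : (∑ s : Pd k, ind A0 q * ind Bp q * tV q s * (1 - ind V s)) = ind A0 q * ind Bp q * ((∑ s : Pd k, tV q s) - ∑ s : Pd k, tV q s * ind V s) := by
        rw [← Finset.sum_sub_distrib, Finset.mul_sum]
        refine Finset.sum_congr rfl fun s _ => ?_; ring
      rw [hsplit, htot]
      have := hindV q
      have e4 : ind A0 q * ind Bp q * ind V q = ind A0 q * ind Bp q := by
        calc ind A0 q * ind Bp q * ind V q = (ind A0 q * ind V q) * ind Bp q := by ring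
          _ = ind A0 q * ind Bp q := by rw [this]
      linear_combination ((2:ℤ) ^ k) * e4
    rw [← e1, hfro, e2, Finset.sum_congr rfl fun q _ => e3 q, Finset.sum_add_distrib, ← Finset.mul_sum, hnBp, hΓ]
  refine diagCert_coProduct_N_orTwo_crossed hS hFx hGy hA dS hdS dV hsub (hNV A0 B0 hA0u hB0u) ?_ hP hQ
  have hnBp0 : 0 ≤ nBp := by
    rw [hnBp]
    exact Finset.sum_nonneg fun q _ => mul_nonneg (mul_nonneg (ind_nonneg' A0 q) (ind_nonneg' Bp q)) (ind_nonneg' V q)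
  linarith [hmix, hfro', hH1, hH2, hH3, hK]

/-- **COROLLARY (the pattern functional at every crossed pair with sections inside the two arms; every `k`).**  With (T) for `dS` and the box `dS ≤ 8·1_S` in addition:
`0 ≤ sStarD ((x∨y) × (↑a ∪ ↑b)) P Q`. [this work] -/
theorem sStarD_blockAnd_orTwo_crossed_twoArms_nonneg (hS : ∀ ξ η : Pd 1, glue ξ η ∈ S ↔ (1 ≤ ξ 0 ∨ 1 ≤ η 0))
    (hFx : ∀ ξ η : Pd 1, glue ξ η ∈ Fx ↔ 1 ≤ ξ 0) (hGy : ∀ ξ η : Pd 1, glue ξ η ∈ Gy ↔ 1 ≤ η 0)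
    (hA : ∀ σ z, glue σ z ∈ A ↔ (σ ∈ S ∧ z ∈ V))
    (dS : Pd (1 + 1) → ℤ) (hdS : dS (glue (fun _ => 0) (fun _ => 0)) = 0 ∧ dS (glue (fun _ => 0) (fun _ => 1)) = 4 ∧ dS (glue (fun _ => 0) (fun _ => 2)) = 4 ∧
      dS (glue (fun _ => 1) (fun _ => 0)) = 2 ∧ dS (glue (fun _ => 1) (fun _ => 1)) = 5 ∧ dS (glue (fun _ => 1) (fun _ => 2)) = 5 ∧
      dS (glue (fun _ => 2) (fun _ => 0)) = 2 ∧ dS (glue (fun _ => 2) (fun _ => 1)) = 5 ∧ dS (glue (fun _ => 2) (fun _ => 2)) = 5)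
    (hTS : ∀ W' : Finset (Pd (1 + 1)), IsUpperSet (W' : Set (Pd (1 + 1))) → (∑ ξ ∈ W', dS ξ) ≤ ∑ ξ ∈ W', lamU S ξ)
    (hmS : ∀ ξ : Pd (1 + 1), dS ξ ≤ 2 * (2:ℤ) ^ (1 + 1) * ind S ξ)
    {a b : Pd k} {Sx : Finset (Fin k)} (hVm : ∀ q, q ∈ V ↔ (a ≤ q ∨ b ≤ q))
    (haS : ∀ i, i ∉ Sx → a i = 0) (hbS : ∀ i, i ∈ Sx → b i = 0)
    {A0 Bp B0 : Finset (Pd k)} (hA0u : IsUpperSet (A0 : Set (Pd k))) (hA0a : ∀ q ∈ A0, a ≤ q) (hB0 : ∀ q, q ∈ B0 ↔ b ≤ q)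
    (hBpu : IsUpperSet (Bp : Set (Pd k))) (hsub : Bp ⊆ B0)
    (dV : Pd k → ℤ)
    (hTV : ∀ W' : Finset (Pd k), IsUpperSet (W' : Set (Pd k)) → (∑ q ∈ W', dV q) ≤ ∑ q ∈ W', lamU V q)
    (hNV : ∀ X X' : Finset (Pd k), IsUpperSet (X : Set (Pd k)) → IsUpperSet (X' : Set (Pd k)) → (∑ q ∈ X, ∑ r ∈ X', thetaVal V q r) ≤ ∑ q ∈ X ∩ X', dV q)
    {P Q : Finset (Pd ((1 + 1) + k))} (hPu : IsUpperSet (P : Set (Pd ((1 + 1) + k)))) (hQu : IsUpperSet (Q : Set (Pd ((1 + 1) + k))))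
    (hP : ∀ σ q, glue σ q ∈ P ↔ (σ ∈ Fx ∧ q ∈ A0)) (hQ : ∀ σ q, glue σ q ∈ Q ↔ (q ∈ Bp ∨ (σ ∈ Gy ∧ q ∈ B0))) :
    0 ≤ sStarD A P Q := by
  rw [sStarD_eq_sum_lamU_sub_sum_thetaVal]
  have hT := diagCert_coProduct_T hA dS dV hTS hTV hmS (isUpperSet_inter_coe hPu hQu)
  have hN := diagCert_coProduct_N_orTwo_crossed_twoArms hS hFx hGy hA dS hdS hVm haS hbS hA0u hA0a hB0 hBpu hsub dV hTV hNV hP hQ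
  linarith

end TwoArms

end Summit.CriticalPhenomena.PercolationContinuityZ3.Theorems.SahiGridPattern
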